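import Mathlib
import HarnessLib
import HarnessLib.Audit
import Summits.HubbardSuperconductivity.Statement
import HarnessLib.Audit.Status.Attr

/-!
Route: ParentFirstSMA

DORMANT since 2026-08-26T10:16:46Z (reconciler: no traction for 8.4 d (last activity item-evidence-added at 2026-08-18T01:04:27Z); parked, not closed — `ledger route dormant route-HubbardSuperconductivity-ParentFirstSMA --off` to reacti) — unstaffed, not closed; items shared with open routes are served there. `ledger route dormant <id> --off` reactivates.

Thesis X (it suffices to show; realises idea card parent-first-ph-flipped-sma-mott-gap — "parent
first": the 2D Mott gap is no theorem, but particle–hole symmetry flips a single-mode UPPER bound on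
the refilling energy into a LOWER bound on Δ_c, U dropping out exactly). X := C1 ∧ C2 ∧ C3 with
(C1, crux #2 HoleSingleModeBelowHalfU) for every U in the window 12 ≤ U ≤ 24 (t = 1) the one-hole
ground state of the half-filled even torus REFILLS BELOW U/2 in the single-mode sense: ∃ ε > 0, L₀
such that for all even L ≥ L₀ some momentum k and some ground state φ of hubbardTorus 2 L 1 U in the
(L²−1)-particle sector satisfy 0 < Z and 2f ≤ (U − ε)·Z, where P = Σ_x e^{2πi k·x/L} c†_{x↓}(1 −
n_{x↑}) (Gutzwiller-projected re-creation), Z = ‖Pφ‖², f = Re⟨Pφ, [T, P]φ⟩, T = hubbardTorus 2 L 1 0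
(the first moment is U-independent because [Σ_x n_{x↑}n_{x↓}, P] = 0 EXACTLY);
(C2, crux #3 BoundCoherentDWavePairs) at some U with 12 ≤ U ≤ 24 two doped holes form, uniformly in
even L, a BOUND pair (2E(L²−1) − E(L²) − E(L²−2) ≥ b > 0, N-sector minima E = groundEnergyAt) that
is d_{x²−y²}-COHERENT (|⟨φ₂, pairField dWaveFormFactor L ψ₀⟩|² ≥ z·L² for some ground states φ₂ of
the (L²−2)-sector and ψ₀ at half filling);
(C3, crux #4 DiluteDWavePairsCondense) for every U with 12 ≤ U ≤ 24: [charge gap chargeGap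
(fermionTorusGraph 2 L) 1 U (L²) ≥ g > 0 for all large even L] → [bound pair as in C2] → [d-coherent
pair as in C2] → ∃ δ ∈ (0, 1/2) with d-wave pair-field LRO of EVERY (N_L, S^z = 0) ground-state
sequence, i.e. the summit's matrix at (U, δ) written out in full (word for word the body of
Literature.Hubbard.DWaveSuperconductivityHubbard after its two existential quantifiers; the
abbreviation HasDWavePairFieldLROAt of the barrier module is deliberately NOT imported — its two
open conjectures PureModelStripeCompetition[Range] would re-enter the cone). WINDOW (rev 2): all
three cruxes are stated on the common window 12 ≤ U ≤ 24 — the unbounded ∀ U ≥ 12 of rev 1 also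
asserted the Nagaoka-polaron tail J/t → 0 of C1 (plausibly false, never used by the Assembly) and
C3's ∀ U > 0 needlessly covered weak coupling; the upper end 24 is the top of the planned census
range (J/t ≥ 1/6), and capping C2's ∃U costs nothing since pair binding only weakens as J = 4t²/U
decreases.
Assembly X → HubbardSuperconductivity: take U from C2; the PH-flipped single-mode theorem (support
MottGapFromSingleMode, PROVABLE NOW: Z·(U − Δ_c(L)) ≤ 2f for every even L ≥ 2, k and one-hole ground
state φ — from the proved particle–hole identity
Literature.MathematicalPhysics.QuantumLattice.groundEnergyAt_fermionTorus_particleHole, E(L²+1) =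
E(L²−1) + U, the exact cancellation of U against the projected refill operator, and the variational
principle; general form = support ProjectedSingleModeBound) turns C1 at that U into the parent Mott
gap Δ_c(L) ≥ ε; C3 then produces δ, and ⟨U, 0 < U (from 12 ≤ U), δ ∈ (0, 1/2), LRO⟩ is literally
HubbardSuperconductivity. DECIDING THEOREM (rev 2, PROVED, axioms
propext/Classical.choice/Quot.sound): `closes : HoleSingleModeBelowHalfU → BoundCoherentDWavePairs →
DiluteDWavePairsCondense → MottGapFromSingleMode → HubbardSuperconductivity` (ε ≤ Δ_c(L) for even L
≥ max(L₀, 2) by nlinarith from 0 < Z, 2f ≤ (U − ε)Z, Z(U − Δ_c) ≤ 2f).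
Lean (one line, decls of this file): `HoleSingleModeBelowHalfU ∧ BoundCoherentDWavePairs ∧
DiluteDWavePairsCondense`; Assembly `HoleSingleModeBelowHalfU → BoundCoherentDWavePairs →
DiluteDWavePairsCondense → HubbardSuperconductivity`; deciding theorem `closes` as above. Constants
(lean search --decl): Literature.MathematicalPhysics.QuantumLattice.{Fock, Orb, FermionTorus,
hubbardTorus, fermionTorusGraph, groundEnergyAt, chargeGap, IsGroundState, IsGroundStateInSector,
IsNParticle, creation, numberOp, orb, pairField, pairFieldCorr, dWaveFormFactor, torusPullback},
Literature.Probability.LatticeModels.{HasLongRangeOrder, halfOpenBox}, HubbardSuperconductivity —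
all from the imports of the sub-problem Statement; route-level imports: none. All six decls and
`closes` elaborate without the barrier import (lean check rc 0, planner Sketch.lean, repair rev 2,
2026-08-15).

Rationale: WHY THIS LINE. Catalogue: nothing imported from another field — an exact lattice symmetry plus
Feynman's single-mode variational bound used upside down; physics enters only as ranked, testable
cruxes. Every underdoped/BEC-side idea here (dilute-pair-bec-bridge, few-holes-first,
schick-log-underdoped-eos, eta-spectroscopy-teleport) presupposes a Mott-insulating parent with
well-defined hole carriers; that charge gap is NOT a theorem in d = 2 at any U
(DattaFernandezFrohlich1999 §1.2/§4, Ueltschi1999 = StrongCouplingCeiling; Langmann–Lenells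
arXiv:2501.18141 treat only the Hartree–Fock gap, 'generally believed … Mott insulator'). On the
even torus E(L²+1) = E(L²−1) + U is PROVED in the tree (groundEnergyAt_fermionTorus_particleHole;
LiebWuPhysicaA2003 eq. (3)), so Δ_c(L) = U − 2[E(L²) − E(L²−1)]: a variational UPPER bound on the
energy to refill the one-hole ground state is a LOWER bound on the Mott gap, and for the projected
refill operator P the interaction commutes out exactly, leaving the U-independent first moment f =
Re⟨Pφ,[T,P]φ⟩ (doi:10.1103/PhysRev.94.262 upside down). The crux is posed in this SHARP first-moment
form, not the card's Cauchy–Schwarz form U − Ct/√Z: the operator-norm constant C ≈ 14–60 certifies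
the parent only for U ≳ 50–3600, outside the pair-binding window, whereas at the coherent momentum
the doublon–hole 'virtual sea' carries only a share ≈ ⟨D⟩/(Z/L²) ≈ 10–15 % of ‖Pφ‖² at U = 12
(double occupancy ≈ 0.03/site, z₀ ≈ 0.3: doi:10.1103/RevModPhys.66.763,
doi:10.1103/PhysRevB.62.15480, doi:10.1103/PhysRevB.44.317), adding ≈ 1t to f/Z ≈ μ⁻ + O(J) ≈
3–3.5t: 2f/Z ≈ 8–9 < 12. Hence the common WINDOW 12 ≤ U ≤ 24 (J = 4t²/U ∈ [t/6, t/3]): the lower end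
is the single-mode threshold, the upper end the top of the planned census range, far from the
Nagaoka-polaron tail J/t ≲ 0.03 where the coherent hole residue z_r ~ e^{−c√(U/4t)} drops below the
k-flat virtual weight z_v ≈ 4.7t²/U² and 2f/Z → ≈ 2U (the reason rev 2 replaced the unbounded ∀ U ≥
12 of #2, and R1's reason for dropping #4's ∀ U > 0: the Assembly uses both only at #3's witness);
the lower edge is also the t-J window where two-hole d_{x²−y²} binding is best documented
(doi:10.1103/RevModPhys.66.763, doi:10.1103/PhysRevB.58.13594, doi:10.1103/PhysRevB.55.6504,
doi:10.1017/cbo9780511584398 §8).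
RANKED CRUXES. #2 HoleSingleModeBelowHalfU (∀ U ∈ [12, 24]; the parent problem as an equal-time
inequality on ONE state; most informative, cheapest to kill: ED/Lanczos/DMRG census of min_k
2f(k)/Z(k) vs U at U = 8–24, L = 4, 6, 8). #3 BoundCoherentDWavePairs (∃ U ∈ [12, 24]: L-uniform
two-hole binding AND d-wave pair coherence; this ∃U is the route's single shared witness). #4
DiluteDWavePairsCondense (∀ U ∈ [12, 24]: gapped parent + bound d-coherent pairs ⇒ d-wave pair-field
LRO at some δ ∈ (0,1/2) for EVERY sector GS — the BEC bridge; hardest, shared in spirit with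
dilute-pair-bec-bridge/few-holes-first; hypotheses copied verbatim from #2/#3's conclusions so the
Assembly composes syntactically). SUPPORTS (rank 9, provable now): ProjectedSingleModeBound (U-blind
single-mode inequality, any sectors, any D-commuting operator), MottGapFromSingleMode (even L: Z(U −
Δ_c) ≤ 2f). ASSEMBLY = #2 → #3 → #4 → HubbardSuperconductivity, bookkeeping except
MottGapFromSingleMode; the deciding theorem `closes` (#2, #3, #4, MottGapFromSingleMode ⊢
HubbardSuperconductivity) is proved in the file (rev 2), so the route closes the moment the three
cruxes and the support MottGapFromSingleMode land.
KILL CRITERIA. (K1) census: min_k 2f/Z ≥ U with no L-stable margin at U = 12–16 → #2 dead as stated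
(one tenure restate of the common threshold if #3 survives it; if f/Z tracks U the hole-coherence
picture fails and the line closes — news either way). (K2) two holes unbound, or φ₂ not d-coherent
(z_L → 0, p/s-like), on L = 6, 8 for every U ∈ [12, 24] → #3 dead; going below 12 needs K1's margin
there, going above 24 buys nothing for binding. (K3) a theorem or landed Literature fact putting
stripes/pair crystals/phase separation at EVERY δ ∈ (0,1/2) for some U meeting #4's hypotheses → #4
and every BEC-side route dead. Supports are theorems; a signature defect is repaired by
set-signature.
NOT DECOMPOSED YET (D-0019): #4 (pair–pair repulsion, T = 0 condensation of interacting 2D bosons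
for every ground state, composite corrections O(δξ²), Koma–Tasaki tower) until #2/#3 evidence lands
and the dilute-pair route fixes its interface; the analytic attack on #2 ('coherence beats the
virtual sea', dressed D-commuting refill operators — ProjectedSingleModeBound already covers them)
until the census fixes numbers; the card's pair-rung η-gap inequality (δ = 0 corner, not
load-bearing). Inspiration notes NOT read (plancard mode).
CHEAPEST FALSIFIER. One exact-diagonalisation run: the 4×4 torus at U = 12, one hole (N = 15, S^z =
½): min over the 16 momenta k of 2f(k)/Z(k) = 2 Re⟨Pφ,[T,P]φ⟩/‖Pφ‖² in the one-hole ground state φ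
(P = projected ↓ re-creation at momentum k) — a value ≥ 12 with no downward trend at L = 6 (Lanczos)
kills #2 at the window's most binding-friendly point (K1), and the same run yields the two-hole
binding energy 2E(15) − E(16) − E(14) and the d-overlap |⟨φ₂, Δ_dψ₀⟩|² for K2. Not run in this
planner seat (compute-free hub; it is the armed hunt's / refuter's first kit job); the analytic
anatomy 2f/Z ≈ [z_r(U − Δ_c) + z_v(2U − O(t))]/(z_r + z_v) + O(J) ≈ 9–10 at U = 12 (refuter review
#3) is the number it tests.

Novelty: Searched this pass: lit search --hybrid 'variational upper bound chemical potential Mott gap lower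
bound Hubbard half filling particle-hole single-mode' (held: Essler 2005, Montorsi vol.,
Oitmaa–Hamer–Zheng doi:10.1017/cbo9780511584398 §8 — no such bound); lit vsearch of the statement in
prose (nothing); crossref 'lower bound charge gap Hubbard half filling' (nearest
doi:10.1007/s00023-005-0214-z: weak coupling, T>0); lit frontier (arXiv:2501.18141: Hartree–Fock AF
gap only, Mott insulator 'generally believed'; arXiv:2410.00810: bootstrap bounds, finite-L tool);
openalex/s2/arxiv 429, lit galaxy rc 75/saturated ×4 (logged; auditor please re-run). Nearest prior
art: LiebPRL1989 (parent uniqueness); LiebWuPhysicaA2003 eq. (3) (PH identity, PROVED in tree: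
groundEnergyAt_fermionTorus_particleHole); doi:10.1103/PhysRev.94.262 (single-mode bound);
projected-creator variational bounds (t-J folklore; in-pool eta-partner-ddw-ceiling,
mott-corner-order-ceiling); doi:10.1103/RevModPhys.66.763, doi:10.1103/PhysRevB.62.15480 (hole
weight, pair binding numerics); DattaFernandezFrohlich1999, Ueltschi1999 (what IS proved). DELTA:
(a) PH flip making a first-moment UPPER bound on the refilling energy a LOWER bound on Δ_c, U
cancelling identically — filed as provable ProjectedSingleModeBound/MottGapFromSingleMode (no
printed source found); (b) parent crux in sharp single-mode (equal-time, one-state) form: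
certifiable threshold U ≈ 12 instead of ≳ 50, inside the pair window (new this pass); (c)  [refs: 10.1017/cbo9780511584398, 10.1007/s00023-005-0214-z:, 10.1103/PhysRev.94.262, 10.1103/RevModPhys.66.763, 10.1103/PhysRevB.62.15480, 2501.18141, 2410.00810, doi:10.1017/cbo9780511584398, doi:10.1007/s00023-005-0214-z, doi:10.1103/PhysRev.94.262, doi:10.1103/RevModPhys.66.763, doi:10.1103/PhysRevB.62.15480, LiebPRL1989, LiebWuPhysicaA2003, DattaFernandezFrohlich1999, Ueltschi1999]

Barriers (technique_class: particle-hole-symmetry single-mode-bound BEC-bridge): technique_class: particle-hole-symmetry single-mode-bound BEC-bridge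
- Literature.Barriers.HubbardSuperconductivity.StrongCouplingCeiling: EVADED by the supports (no
expansion: exact symmetry + exact commutator + variational principle), MET HEAD-ON by crux #2, where
its content (no control of the SU(2) ground state) becomes an equal-time one-state inequality
testable by ED.
- Literature.Barriers.HubbardSuperconductivity.PureModelStripeCompetition: APPLIES to crux #4 (t'=0
stripes at U=8, δ=1/8); only skirted: #4 needs SOME δ at a U ≥ 12 where #2/#3 hold (δ→0⁺ or away
from 1/8; Sorella2023), never IsCuprateRegimeWitness; it is #4's why-might-fail and kill criterion
K3.
- Literature.Barriers.HubbardSuperconductivity.LROForcesLowLyingStates: consistent — LRO claimed for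
EVERY sector GS, no unique gapped doped GS assumed; parent gap = CHARGE gap; no anomalous average
asserted.
- Literature.Barriers.HubbardSuperconductivity.SignProblemNPHard: censuses (1–2 holes, L ≤ 8, ED)
are evidence, never certificates.
- Literature.Barriers.HubbardSuperconductivity.WeakCouplingCeiling,
Literature.Barriers.HubbardSuperconductivity.PerturbativeInvisibilityOfPairing,
Literature.Barriers.HubbardSuperconductivity.PerturbativeInvisibilityOfPairingNarrow,
Literature.Barriers.HubbardSuperconductivity.GeneralizedHartreeFockNoPairing,
Literature.Barriers.HubbardSuperconductivity.HohenbergMerminWagnerPairing,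
Literature.Barriers.HubbardSuperconductivity.PositiveTemperatureNoPairLRO: no contact (U ≥ 12,

Novelty grade: new-combination — ROUTE REVIEW #2 refuter c8da4637 (evidence REVIEW2-ParentFirstSMA.md on route + 2356). NOVELTY new-combination: Feynman's single-mode variational UPPER bound used one-sidedly with a D-commuting (Gutzwiller-projected) refill operator, so that U cancels identically, + the even-torus particle–hole iden (refuter refuter-rreview-route-HodgeConjecture-In-c8da4637-0, 2026-08-15T12:37:42Z; prior: Feynman 1954 doi:10.1103/PhysRev.94.262 (single-mode bound), LiebWuPhysicaA2003 eq.(3) (PH identity; proved in tree), LiebPRL1989, Dagotto 1994 doi:10.1103/RevModPhys.66.763, doi:10.1103/PhysRevB.62.15480, DattaFernandezFrohlich1999, Ueltschi1999, arXiv:2501.18141)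

History (route lifecycle, newest last):
- 2026-08-15T16:23:36Z · rev 2: restated HoleSingleModeBelowHalfU (stmt-HubbardSuperconductivity-2354), BoundCoherentDWavePairs (stmt-HubbardSuperconductivity-2355), DiluteDWavePairsCondense (stmt-HubbardSuperconductivity-2356) — route-repair (glue + cone, rrepair g2): (1) DECIDING THEOREM `closes : HoleSingleModeBelowHalfU → BoundCoherentDWav (planner-rbadge-HubbardSuperconductivity-Parent-2523fdf4-g2-0)
- 2026-08-26T10:16:46Z · DORMANT — reconciler: no traction for 8.4 d (last activity item-evidence-added at 2026-08-18T01:04:27Z); parked, not closed — `ledger route dormant route-HubbardSupercond (operator:999:3994515)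

sub-problem: HubbardSuperconductivity · status: dormant · opened planner-plancard-HubbardSuperconductivity-Hub-4f39cf08-0 2026-08-15T11:03:18Z · rev 2 · ledger route-HubbardSuperconductivity-ParentFirstSMA
GENERATED by the gate from the ledger (D-0016/17). Provers cite these decls: `theorem foo : Summit.HubbardSuperconductivity.HubbardSuperconductivity.Theses.ParentFirstSMA.<Decl> := …` in Summits/HubbardSuperconductivity/HubbardSuperconductivity/Theorems/<Name>.lean.
-/

namespace Summit.HubbardSuperconductivity.HubbardSuperconductivity.Theses.ParentFirstSMA

open scoped BigOperators Topology Manifold Classical MeasureTheory ProbabilityTheory Matrix InnerProductSpace ComplexConjugate ContinuousMap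
open Filter Set Function TopologicalSpace MeasureTheory

attribute [summit_statement] _root_.HubbardSuperconductivity

open Literature.Hubbard

-- earlier HoleSingleModeBelowHalfU (stmt-HubbardSuperconductivity-2354, replaced 2026-08-15T16:23:36Z -> stmt-HubbardSuperconductivity-10769): retired by None — open Literature.MathematicalPhysics.QuantumLattice in ∀ U : ℝ, 12 ≤ U → ∃ ε : ℝ, 0 < ε ∧ ∃ L₀ : ℕ, ∀ L : ℕ, L₀ ≤ L → Even L → ∃ (k : Fin 2 → Fin L) (φ : Fock (Orb (FermionTorus 2 L))), IsGroundState (hubbardTorus 2 L 1 U) (L ^ 2 - 1) φ ∧ sta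
/-- item stmt-HubbardSuperconductivity-10769 · crux · rank 2 · open · by planner
why it might fail: Needs coherent hole residue z_r(L) ≫ virtual doublon–hole weight z_v≈4.7t²/U² at one k, uniformly in L, on all of [12,24] (J/t∈[1/6,1/3]): (i) z_r→0 as L→∞ (2D hole incoherence; QMC controls z only for J/t≥0.6) kills it; (ii) at U=12, 2f/Z≈9–10<12 rests on z_r≈0.3, μ⁻≈3t — a thin margin.
sources: doi:10.1103/PhysRev.94.262, doi:10.1103/RevModPhys.66.763, doi:10.1103/PhysRevB.62.15480, doi:10.1103/PhysRevB.44.317, doi:10.1103/PhysRevB.64.024411, Nagaoka1966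
[crux] For every U in the window 12 ≤ U ≤ 24 (t = 1): ∃ ε > 0, L₀ s.t. for all even L ≥ L₀ some
momentum k and some normalised ground state φ of hubbardTorus 2 L 1 U in the (L²−1)-particle sector
satisfy 0 < Z and 2f ≤ (U − ε)Z, where P = Σ_x e^{2πi k·x/L} • creation (orb x 1) * (1 − numberOp x
0) (projected re-creation of a ↓ electron on EMPTY sites only; un-normalised: Z/L² ≍ z₀/2 at the
quasiparticle momentum), Z = Re⟨Pφ,Pφ⟩, f = Re⟨Pφ,(TP − PT)φ⟩, T = hubbardTorus 2 L 1 0. MEANING: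
the single-mode REFILLING energy f/Z of the doped hole stays below U/2 uniformly in L; f is
U-independent since [Σ n↑n↓, P] = 0 exactly (an equal-time finite-range quadratic form in ONE
state). With support MottGapFromSingleMode (Z(U − Δ_c) ≤ 2f) this IS the parent Mott gap Δ_c(L) ≥ ε
on the window. WINDOW (repair rev 2; refuter review #3 objection O1 and the retriage shape note):
rev 1's unbounded ∀ U ≥ 12 also asserted the Nagaoka-polaron tail J/t = 4t/U → 0, where the coherent
residue z_r ~ e^{−c√(U/4t)} falls below the k-flat virtual doublon–hole weight z_v ≈ 4.7t²/U² and
2f/Z → ≈ 2U > U − ε at every k — plausibly false and never used, since the Assembly needs C1 only at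
the witness U ∈ [12, 24] -/
@[route_item "route-HubbardSuperconductivity-ParentFirstSMA", crux]
def HoleSingleModeBelowHalfU : Prop :=
  open Literature.MathematicalPhysics.QuantumLattice in ∀ U : ℝ, 12 ≤ U → U ≤ 24 → ∃ ε : ℝ, 0 < ε ∧ ∃ L₀ : ℕ, ∀ L : ℕ, L₀ ≤ L → Even L → ∃ (k : Fin 2 → Fin L) (φ : Fock (Orb (FermionTorus 2 L))), IsGroundState (hubbardTorus 2 L 1 U) (L ^ 2 - 1) φ ∧ star φ ⬝ᵥ φ = 1 ∧ (let P : Matrix (Finset (Orb (FermionTorus 2 L))) (Finset (Orb (FermionTorus 2 L))) ℂ := ∑ x : FermionTorus 2 L, Complex.exp (2 * Real.pi * Complex.I * (∑ i : Fin 2, ((ofLex x i : ℕ) : ℂ) * ((k i : ℕ) : ℂ)) / (L : ℂ)) • (creation (orb x 1) * (1 - numberOp x 0)); 0 < (star (P *ᵥ φ) ⬝ᵥ (P *ᵥ φ)).re ∧ 2 * (star (P *ᵥ φ) ⬝ᵥ ((hubbardTorus 2 L 1 0 * P - P * hubbardTorus 2 L 1 0) *ᵥ φ)).re ≤ (U -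 ε) * (star (P *ᵥ φ) ⬝ᵥ (P *ᵥ φ)).re)

-- earlier BoundCoherentDWavePairs (stmt-HubbardSuperconductivity-2355, replaced 2026-08-15T16:23:36Z -> stmt-HubbardSuperconductivity-10770): retired by None — open Literature.MathematicalPhysics.QuantumLattice in ∃ U : ℝ, 12 ≤ U ∧ (∃ b : ℝ, 0 < b ∧ ∃ L₀ : ℕ, ∀ L : ℕ, L₀ ≤ L → Even L → b ≤ 2 * groundEnergyAt (fermionTorusGraph 2 L) 1 U (L ^ 2 - 1) - groundEnergyAt (fermionTorusGraph 2 L) 1 U (L ^ 2)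
/-- item stmt-HubbardSuperconductivity-10770 · crux · rank 3 · open · by planner
why it might fail: U≥12 forces t/J≥3, past the series crossover t/J≈2.5 where two-hole d-states unbind (p weakly bound); ED binding |E_b|≈0.1–0.3t shrinks 16→32 sites and naive FSS gives no bound state at the smaller J/t; the torus two-hole GS may be p-like or at P≠0 on some even L (no overlap with Δ_dψ₀), or z_L→0.
sources: doi:10.1103/RevModPhys.66.763, doi:10.1103/PhysRevB.58.13594, doi:10.1103/PhysRevB.55.6504, doi:10.1017/cbo9780511584398, Nagaoka1966, Tasaki1998
[crux] ∃ U with 12 ≤ U ≤ 24 such that for all even L ≥ L₀: (i) two-hole BINDING b ≤ 2E(L²−1) − E(L²)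
− E(L²−2), b > 0, E = groundEnergyAt (fermionTorusGraph 2 L) 1 U · (N-sector minima); (ii) d_{x²−y²}
PAIR COHERENCE z·L² ≤ |⟨φ₂, Δψ₀⟩|² for some normalised ground states φ₂ ((L²−2)-sector), ψ₀ (half
filling), Δ = pairField dWaveFormFactor L = Σ_x Σ_{e=±e₁,±e₂} (g_d(e)/√2)(c_{x↑}c_{x+e↓} −
c_{x↓}c_{x+e↑}) (zero-momentum singlet d-wave pair annihilator; ‖Δψ₀‖² = O(L²) in the gapped parent,
so z = pair quasiparticle weight × O(1); `[NeZero L]` is only what pairField needs). WHY HERE: crux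
#4 needs bound d-coherent pairs at the SAME U at which crux #2 certifies the parent — this ∃U is the
route's one shared witness, confined (repair rev 2) to the common window [12, 24] of #2/#4: U ≥ 12 ⇔
J = 4t²/U ≤ t/3 is the edge of the t-J window where two-hole d_{x²−y²} bound states are documented
(ED √20–32 sites, DMRG, series), and the cap U ≤ 24 costs nothing because binding only weakens as J
decreases. By particle–hole symmetry Δ_b = [E(L²−1) − E(L²−2)] − [E(L²) − E(L²−1)];
ProjectedSingleModeBound bounds the subtracted term above by f/Z, so half of (i) is a first-moment
computation (card); the -/
@[route_item "route-HubbardSuperconductivity-ParentFirstSMA", crux]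
def BoundCoherentDWavePairs : Prop :=
  open Literature.MathematicalPhysics.QuantumLattice in ∃ U : ℝ, 12 ≤ U ∧ U ≤ 24 ∧ (∃ b : ℝ, 0 < b ∧ ∃ L₀ : ℕ, ∀ L : ℕ, L₀ ≤ L → Even L → b ≤ 2 * groundEnergyAt (fermionTorusGraph 2 L) 1 U (L ^ 2 - 1) - groundEnergyAt (fermionTorusGraph 2 L) 1 U (L ^ 2) - groundEnergyAt (fermionTorusGraph 2 L) 1 U (L ^ 2 - 2)) ∧ (∃ z : ℝ, 0 < z ∧ ∃ L₀ : ℕ, ∀ (L : ℕ) [NeZero L], L₀ ≤ L → Even L → ∃ φ₂ ψ₀ : Fock (Orb (FermionTorus 2 L)), IsGroundState (hubbardTorus 2 L 1 U) (L ^ 2 - 2) φ₂ ∧ star φ₂ ⬝ᵥ φ₂ = 1 ∧ IsGroundState (hubbardTorus 2 L 1 U) (L ^ 2) ψ₀ ∧ star ψ₀ ⬝ᵥ ψ₀ = 1 ∧ z * (L : ℝ) ^ 2 ≤ ‖star φ₂ ⬝ᵥ (pairField dWaveFormFactor L *ᵥ ψ₀)‖ ^ 2)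

-- earlier DiluteDWavePairsCondense (stmt-HubbardSuperconductivity-2356, replaced 2026-08-15T16:23:36Z -> stmt-HubbardSuperconductivity-10771): retired by None — open Literature.MathematicalPhysics.QuantumLattice in ∀ U : ℝ, 0 < U → (∃ g : ℝ, 0 < g ∧ ∃ L₀ : ℕ, ∀ L : ℕ, L₀ ≤ L → Even L → g ≤ chargeGap (fermionTorusGraph 2 L) 1 U (L ^ 2)) → (∃ b : ℝ, 0 < b ∧ ∃ L₀ : ℕ, ∀ L : ℕ, L₀ ≤ L → Even L → b ≤ 2 *
/-- item stmt-HubbardSuperconductivity-10771 · crux · rank 4 · open · by planner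
why it might fail: t'=0: 'CDW order wins over SC for t′≤0' (DMRG/DQMC consensus: filled stripes at U=8, δ=1/8; width-6 insulating 2/3-filled stripes); phase separation may pre-empt the dilute pair gas as δ→0⁺ (EKL 1990); no T=0 BEC theorem for interacting 2D bosons, let alone composite pairs in EVERY sector GS.
sources: QinEtAl2020, XuEtAl2024, Sorella2023, ArovasBergKivelsonRaghu2022, doi:10.1016/j.physc.2025.1354683, doi:10.1103/PhysRevLett.113.046402
[crux] BEC BRIDGE, for every U in the window 12 ≤ U ≤ 24: IF (a) the parent has a charge gap
uniformly in even L (g ≤ chargeGap (fermionTorusGraph 2 L) 1 U (L²), L ≥ L₀), (b) two holes bind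
uniformly (clause (i) of crux #3 verbatim) and (c) the bound pair is d_{x²−y²}-coherent (clause (ii)
verbatim), THEN some δ ∈ (0, 1/2) has d-wave pair-field LRO for EVERY normalised (N_L, S^z = 0)
ground-state sequence along even sides — the summit's matrix at (U, δ) written out in full (word for
word the body of Literature.Hubbard.DWaveSuperconductivityHubbard after its two existential
quantifiers; provers: do NOT import
Literature.Barriers.HubbardSuperconductivity.PureModelStripeCompetition for the abbreviation
HasDWavePairFieldLROAt — its two open conjectures would re-enter the cone). CONTENT: a dilute gas
(density ≈ δ/2) of tightly bound bosonic d-wave pairs in a charge-gapped Mott background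
Bose-condenses at T = 0 in d = 2, L⁻⁴⟨Δ_d†Δ_d⟩ ≈ (pair density)·z inheriting B₁g from (c)
(Randeria–Duan–Shieh). HARDEST item; a proof must add pair–pair repulsion / stability against phase
separation, stripes, pair density waves at the chosen δ (δ → 0⁺ or away from 1/8; QinEtAl2020's t' =
0 stripes are -/
@[route_item "route-HubbardSuperconductivity-ParentFirstSMA", crux]
def DiluteDWavePairsCondense : Prop :=
  open Literature.MathematicalPhysics.QuantumLattice in ∀ U : ℝ, 12 ≤ U → U ≤ 24 → (∃ g : ℝ, 0 < g ∧ ∃ L₀ : ℕ, ∀ L : ℕ, L₀ ≤ L → Even L → g ≤ chargeGap (fermionTorusGraph 2 L) 1 U (L ^ 2)) → (∃ b : ℝ, 0 < b ∧ ∃ L₀ : ℕ, ∀ L : ℕ, L₀ ≤ L → Even L → b ≤ 2 * groundEnergyAt (fermionTorusGraph 2 L) 1 U (L ^ 2 - 1) - groundEnergyAt (fermionTorusGraph 2 L) 1 U (L ^ 2) - groundEnergyAt (fermionTorusGraph 2 L) 1 U (L ^ 2 - 2)) → (∃ z : ℝ, 0 < z ∧ ∃ L₀ : ℕ, ∀ (L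 : ℕ) [NeZero L], L₀ ≤ L → Even L → ∃ φ₂ ψ₀ : Fock (Orb (FermionTorus 2 L)), IsGroundState (hubbardTorus 2 L 1 U) (L ^ 2 - 2) φ₂ ∧ star φ₂ ⬝ᵥ φ₂ = 1 ∧ IsGroundState (hubbardTorus 2 L 1 U) (L ^ 2) ψ₀ ∧ star ψ₀ ⬝ᵥ ψ₀ = 1 ∧ z * (L : ℝ) ^ 2 ≤ ‖star φ₂ ⬝ᵥ (pairField dWaveFormFactor L *ᵥ ψ₀)‖ ^ 2) → ∃ δ ∈ Set.Ioo (0 : ℝ) (1 / 2), ∀ (N : ℕ → ℕ) (ψ : ∀ L, Fock (Orb (FermionTorus 2 L))), (∀ L, Even L → N L = 2 * ⌊(1 - δ) * (L : ℝ) ^ 2 / 2⌋₊ ∧ star (ψ L) ⬝ᵥ ψ L = 1 ∧ IsGroundStateInSector (hubbardTorus 2 L 1 U) (N L) 0 (ψ L)) → Literature.Probability.LatticeModels.HasLongRangeOrder (fun k => Literature.Probability.LatticeModels.halfOpenBox 2 (2 * k)) (fun k => torusPullback (pairFieldCorr dWaveFormFactor ψ) (2 * k))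

/-- item stmt-HubbardSuperconductivity-2357 · support · rank 9 · closed · proved by Summit.HubbardSuperconductivity.HubbardSuperconductivity.Theorems.ParentFirstSMA.projectedSingleModeBound_proof (prover) · by planner
sources: doi:10.1103/PhysRev.94.262, LiebWuPhysicaA2003
[support] PROVABLE NOW (half a page; the route's engine in full generality). For every U : ℝ, every
L, sectors N M : ℕ, every matrix A on the torus Fock space commuting with D = Σ_x numberOp x 0 *
numberOp x 1, and every ground state φ of hubbardTorus 2 L 1 U in the N-particle sector with Aφ an
M-particle vector: ‖Aφ‖²·(E(M) − E(N)) ≤ Re⟨Aφ,(TA − AT)φ⟩, E = groundEnergyAt (fermionTorusGraph 2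
L) 1 U, T = hubbardTorus 2 L 1 0. PROOF: hubbardTorus 2 L 1 U = T + U•D (unfold `hamiltonian`); Hφ =
E(N)φ; H(Aφ) = A(Hφ) + [T,A]φ + U[D,A]φ with [D,A] = 0 — U drops out EXACTLY; the variational
definition of Literature.MathematicalPhysics.QuantumLattice.groundEnergy (inf of Re⟨ψ,Hψ⟩ over unit
M-particle ψ; csInf_le, bounded below) at Aφ/‖Aφ‖ gives E(M)‖Aφ‖² ≤ Re⟨Aφ,HAφ⟩ = E(N)‖Aφ‖² +
Re⟨Aφ,[T,A]φ⟩ (trivial if Aφ = 0). Feynman's single-mode bound for D-commuting modes. USES: A = P of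
crux #2 (c†_{x↓}(1 − n_{x↑}) commutes with every n_{y↑}n_{y↓}: y ≠ x disjoint even factor, y = x as
n_{x↑}(1 − n_{x↑}) = 0), N = L²−1, M = L² → MottGapFromSingleMode; N = L²−2, M = L²−1 → favourable
half of binding (crux #3); projected d-wave pair creator, M = N+2 → the card's η-gap rung. -/
@[route_item "route-HubbardSuperconductivity-ParentFirstSMA"]
def ProjectedSingleModeBound : Prop :=
  open Literature.MathematicalPhysics.QuantumLattice in ∀ (U : ℝ) (L N M : ℕ) (A : Matrix (Finset (Orb (FermionTorus 2 L))) (Finset (Orb (FermionTorus 2 L))) ℂ) (φ : Fock (Orb (FermionTorus 2 L))), IsGroundState (hubbardTorus 2 L 1 U) N φ → A * (∑ x : FermionTorus 2 L, numberOp x 0 * numberOp x 1) = (∑ x : FermionTorus 2 L, numberOp x 0 * numberOp x 1) * A → IsNParticle M (A *ᵥ φ) → (star (A *ᵥ φ) ⬝ᵥ (A *ᵥ φ)).re * (groundEnergyAt (fermionTorusGraph 2 L) 1 U M - groundEnergyAt (fermionTorusGraph 2 L) 1 U N) ≤ (star (A *ᵥ φ) ⬝ᵥ ((hubbardTorus 2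 L 1 0 * A - A * hubbardTorus 2 L 1 0) *ᵥ φ)).re

-- `ProjectedSingleModeBound` holds: proved by `Summit.HubbardSuperconductivity.HubbardSuperconductivity.Theorems.ParentFirstSMA.projectedSingleModeBound_proof` (its module imports this route file, so no `_holds` link can be stated here).

/-- item stmt-HubbardSuperconductivity-2358 · support · rank 9 · closed · proved by Summit.HubbardSuperconductivity.HubbardSuperconductivity.Theorems.ParentFirstSMA.mottGapFromSingleMode_proof (prover) · by planner
sources: LiebWuPhysicaA2003, LiebPRL1989, doi:10.1103/PhysRev.94.262
[support] PROVABLE NOW from ProjectedSingleModeBound + particle–hole symmetry; the Assembly's only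
non-bookkeeping step. For every U, every EVEN L ≥ 2, k : Fin 2 → Fin L and ground state φ of
hubbardTorus 2 L 1 U in the (L²−1)-particle sector: Z·(U − Δ_c(L)) ≤ 2f with P, Z = Re⟨Pφ,Pφ⟩, f =
Re⟨Pφ,(TP − PT)φ⟩ exactly as in crux #2, Δ_c(L) = chargeGap (fermionTorusGraph 2 L) 1 U (L²) =
E(L²+1) + E(L²−1) − 2E(L²). PROOF:
Literature.MathematicalPhysics.QuantumLattice.groundEnergyAt_fermionTorus_particleHole (PROVED; even
L, N = L²−1 ≤ 2L²) gives E(L²−1) = E(L²+1) − U, so U − Δ_c(L) = 2(E(L²) − E(L²−1));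
ProjectedSingleModeBound with A = P, N = L²−1, M = L² (P commutes with Σ n↑n↓; Pφ is an L²-particle
vector: creation raises, numberOp preserves particle number) gives Z(E(L²) − E(L²−1)) ≤ f; double
it. Used by the Assembly as: 0 < Z ∧ 2f ≤ (U − ε)Z ⇒ Δ_c(L) ≥ ε. This is the card's theorem 'hole
coherence ⇒ Mott insulator' in first-moment form: particle–hole symmetry turns Feynman's UPPER bound
into a LOWER bound on the Mott gap, U cancelling identically (LiebWuPhysicaA2003 eq. (3);
doi:10.1103/PhysRev.94.262). -/
@[route_item "route-HubbardSuperconductivity-ParentFirstSMA", crux]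
def MottGapFromSingleMode : Prop :=
  open Literature.MathematicalPhysics.QuantumLattice in ∀ (U : ℝ) (L : ℕ) (k : Fin 2 → Fin L) (φ : Fock (Orb (FermionTorus 2 L))), Even L → 2 ≤ L → IsGroundState (hubbardTorus 2 L 1 U) (L ^ 2 - 1) φ → (let P : Matrix (Finset (Orb (FermionTorus 2 L))) (Finset (Orb (FermionTorus 2 L))) ℂ := ∑ x : FermionTorus 2 L, Complex.exp (2 * Real.pi * Complex.I * (∑ i : Fin 2, ((ofLex x i : ℕ) : ℂ) * ((k i : ℕ) : ℂ)) / (L : ℂ)) • (creation (orb x 1) * (1 - numberOp x 0)); (star (P *ᵥ φ) ⬝ᵥ (P *ᵥ φ)).re * (U - chargeGap (fermionTorusGraph 2 L) 1 U (L ^ 2)) ≤ 2 * (star (P *ᵥ φ) ⬝ᵥ ((hubbardTorus 2 L 1 0 * P - P * hubbardTorus 2 L 1 0) *ᵥ φ)).re)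

-- `MottGapFromSingleMode` holds: proved by `Summit.HubbardSuperconductivity.HubbardSuperconductivity.Theorems.ParentFirstSMA.mottGapFromSingleMode_proof` (its module imports this route file, so no `_holds` link can be stated here).

/-- item stmt-HubbardSuperconductivity-2359 · assembly · rank 1 · closed · proved by Summit.HubbardSuperconductivity.HubbardSuperconductivity.Theorems.ParentFirstSMA.parentFirstSMA_assembly_proof (prover) · by planner
sources: Scalapino1995, ArovasBergKivelsonRaghu2022
[assembly] From BoundCoherentDWavePairs take U with 12 ≤ U (so 0 < U), binding (i), pair coherence
(ii); HoleSingleModeBelowHalfU at U gives ε > 0, L₀ and for each even L ≥ max(L₀,2) a pair (k, φ)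
with 0 < Z, 2f ≤ (U − ε)Z; MottGapFromSingleMode (support, provable now — prove alongside or cite
its landed theorem) gives Z(U − Δ_c) ≤ 2f ≤ (U − ε)Z hence chargeGap ≥ ε: hypothesis (a) of
DiluteDWavePairsCondense with g = ε; (b), (c) are (i), (ii) verbatim (identical Lean text); get δ ∈
Ioo 0 (1/2) with HasDWavePairFieldLROAt U δ; ⟨U, _, δ, _, h⟩ is HubbardSuperconductivity (body =
HasDWavePairFieldLROAt U δ by Iff.rfl, cf. PureModelStripeCompetitionProofs.lean). Bookkeeping apart
from MottGapFromSingleMode. -/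
@[route_item "route-HubbardSuperconductivity-ParentFirstSMA"]
def Assembly : Prop :=
  HoleSingleModeBelowHalfU → BoundCoherentDWavePairs → DiluteDWavePairsCondense → HubbardSuperconductivity

-- `Assembly` holds: proved by `Summit.HubbardSuperconductivity.HubbardSuperconductivity.Theorems.ParentFirstSMA.parentFirstSMA_assembly_proof` (its module imports this route file, so no `_holds` link can be stated here).

/-! D-0027 §2.1 — DECIDING THEOREM (planner-authored via `route open/edit --closes-file`; by planner-rbadge-HubbardSuperconductivity-Parent-2523fdf4-g2-0 2026-08-15T16:23:36Z):
its hypotheses are this route's items and its conclusion the sub-problem Statement (glue_lint), and it elaborates with this file. -/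

@[closes "route-HubbardSuperconductivity-ParentFirstSMA"] theorem closes (h₁ : HoleSingleModeBelowHalfU) (h₂ : BoundCoherentDWavePairs)
    (h₃ : DiluteDWavePairsCondense) (h₄ : MottGapFromSingleMode) :
    _root_.HubbardSuperconductivity := by
  obtain ⟨U, hU12, hU24, hbind, hcoh⟩ := h₂
  have hUpos : (0 : ℝ) < U := by linarith
  obtain ⟨ε, hε, L₀, hL⟩ := h₁ U hU12 hU24
  have key : ∀ {Z f Δ U' ε' : ℝ}, 0 < Z → 2 * f ≤ (U' - ε') * Z → Z * (U' - Δ) ≤ 2 * f →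
      ε' ≤ Δ := by
    intro Z f Δ U' ε' hZ hf hm
    nlinarith
  obtain ⟨δ, hδ, hLRO⟩ := h₃ U hU12 hU24 ⟨ε, hε, max L₀ 2, fun L hL' hLeven => by
      obtain ⟨k, φ, hgs, -, hZpos, hf⟩ := hL L (le_trans (le_max_left _ _) hL') hLeven
      exact key hZpos hf (h₄ U L k φ hLeven (le_trans (le_max_right _ _) hL') hgs)⟩ hbind hcoh
  exact ⟨U, hUpos, δ, hδ, hLRO⟩

end Summit.HubbardSuperconductivity.HubbardSuperconductivity.Theses.ParentFirstSMA
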